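/-
Copyright: the b2b-balaban T⁴-continuum CRUX team, row NE7b OWNER lineage `t4-ne7b-p1` (gen 121). Project licence.
-/
import Summits.QuantumFields.BalabanUV.T4Continuum.Spine.NE7b.SupTorusMaximumPrinciple

/-!
# `‖H_V⁻¹‖_{ℓ^∞ → ℓ^∞} ≤ C(d, a, v₀)` ON THE STRICTLY CONVEX SINGLE-SITE CLASS `V ≥ v₀ > 0` — EVERY SOURCE, every mesh, every volume: for
# `H_V = (n+1)²(−Δ) + a(n+1)^{−d}(block sums) + V` on `(ℤ∕(n+1)s)^d` and ANY `f`, the solution of `H_Vu = f` has `‖u‖_∞ ≤ C‖f‖_∞`,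
# `C = (1 + a·m_κ⁻¹e^{2dκ}K_κ)∕v₀`; on the way: the displayed action is ONTO (the block columns `ψ_{y′} = H⁻¹𝟙_{B_{y′}}` of (134)–(147) EXIST,
# their hypothesis discharged), and by DUALITY the block means of `H⁻¹f` are `≤ m_κ⁻¹e^{2dκ}K_κ‖f‖_∞` with no support condition — § NEXT (3)(b)
# «row sums `O(1)` uniformly in the mesh» on this class (row NE7b, node U5c; (131)–(134), (144) BY NAME; [folklore])

Cell `pub-balaban`, sub-cell `t4`, spine estimate NE7b (`T4WeightBudget.RelWeightBound`; the cell's OWN estimate — NOT PRINTED in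
[Bałaban 1983–89], NOT PROVED).  Crux-route work under `Spine/NE7b/` by the row OWNER (`t4-ne7b-p1` gen 121, file (148)) under FREEZE
(0)'s crux-prover clause; NOTHING of Bałaban's is named as a Lean object, valued or asserted; no `T4Continuum/Support` leaf typed; no `def`,
no notation (the action DISPLAYED; the linear map behind surjectivity is a LOCAL `let` inside the proof, not a declaration); zero `sorry`.
Imports (BY NAME): the OWNER's (144) `…SupTorusMaximumPrinciple` (`maxPrinciple`, `blockTerm_eq`; through it (135) `action_smul`, (134)
`schur_column_sq_le`, (133) `action_form_symm`, `action_sub`, `action_injective`, `sum_indicator_mul`, (132) `isPseudoDist_torus`,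
`torus_sum_exp_le`, (131) `exists_rate`, (89) TDF `sum_fine_eq_sum_blocks`, `siteOf_chart_surjective`), Mathlib's
`LinearMap.injective_iff_surjective`, `sq_sum_le_card_mul_sum_sq`.

WHY (located).  (144)∕(147) bound `H⁻¹f` pointwise for sources in ONE block; the operator-norm statement for ARBITRARY `f` needs the block
means of `u = H⁻¹f` without a support condition.  DUALITY supplies them: the form of `H` is symmetric ((133)), so
`Σ_{B_y}u = ⟨𝟙_{B_y}, H⁻¹f⟩ = ⟨H⁻¹𝟙_{B_y}, f⟩ = ⟨ψ_y, f⟩ ≤ ‖ψ_y‖_{ℓ¹}‖f‖_∞`, and `‖ψ_y‖_{ℓ¹} = Σ_{y′}Σ_{B_{y′}}|ψ_y| ≤ Σ_{y′}(n+1)^{d∕2}‖ψ_y‖_{ℓ²(B_{y′})}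
≤ (n+1)^d·m_κ⁻¹e^{2dκ}Σ_{y′}e^{−κρ_s(y′,y)} ≤ (n+1)^d·m_κ⁻¹e^{2dκ}K_κ` by (134) `schur_column_sq_le` and (132) — exactly one block volume, which
the mean divides out.  Then `L_Vu = f − a·(block means)` and (144) `maxPrinciple`.  The columns themselves exist because the displayed
action is an injective ((133) `action_injective`) linear endomorphism of a finite-dimensional space.

WHAT IS PROVED ([folklore]; fine torus `Site d ((n+1)s)`, coarse `Site d s`, `[NeZero s]`; the action DISPLAYED; `bt x = σ_s(blk n (wm x))`;
`m_κ = min(2,a) − λ − 2dκ² − a(e^{2dκ} − 1)`; `K_κ = (2∕(1 − e^{−κ}))^d`):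
* §1 **`action_surjective`** (`a ≥ 0`, `V ≥ −λ`, `λ < min(2,a)`: every `f` is `Hu`), **`exists_blockColumns`** (`∃ ψ`, `Hψ_{y′} = 𝟙[bt · = y′]`
  for all `y′`).
* §2 `blockSum_eq_pairing` (`Σ_z u(σ(chart (wm y) z)) = Σ_x ψ_y x·f x`), **`column_l1_le`** (`Σ_x |ψ_y x| ≤ (n+1)^d·m_κ⁻¹e^{2dκ}K_κ`),
  **`blockMean_le_sup`** (`|f| ≤ M` ⟹ `|(n+1)^{−d}Σ_z u(σ(chart (wm y) z))| ≤ m_κ⁻¹e^{2dκ}K_κ·M`, EVERY source).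
* §3 THE HEADLINE **`supNorm_bound`**: `∃ C > 0` from `(d, a, v₀)` only (`a > 0`, `v₀ > 0`) such that for ALL `n, s`, ALL `V ≥ v₀`, EVERY
  `f` with `|f| ≤ M` and every `Hu = f`: `|u x| ≤ C·M` at every site.
* §4 toy.

HONEST (what this is NOT).  The STRICTLY CONVEX single-site class only (`V ≥ v₀ > 0`) for the sup bound (§1–§2 hold on the road's class
`V ≥ −λ`); an operator-NORM bound, not decay (decay from a block source is (147)); constants explicit, far from sharp; cubic periods; scalar
skeleton ((A3), NC-NE7b-α UNRULED); nothing of the covariant propagators of [B4]–[B6]; nothing of Bałaban's.  BY-NAME EFFECT ON THE WALL: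
NONE.  NE7b NOT PRINTED ∕ NOT PROVED; spine PROVED 0∕9; rung (B)+1 on a FINITE torus — NOT infinite volume, NOT the mass gap, NOT Clay.
HONEST DEPENDENCY: continuum YM on T⁴ ⇐ BetaPertH ∧ nine spine estimates (0∕9 proved); BetaPertH ⇐ (D1) ∧ (D4) ∧ CAP+tail; G-an2-4 gates
asym, D1 and NE2∕3∕4.
-/

set_option autoImplicit false

noncomputable section

namespace Summit.QuantumFields.BalabanUV.T4Continuum.NE7b.SupTorusSupNormBound

open Real
open Literature.MathematicalPhysics.QuantumFieldTheory.Balaban1983to89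
open B6QGQLower276 (X e blk B side chart mem_B sum_B sum_B_const card_cube blk_chart)
open Beta (Site siteOf windowMap siteOf_windowMap siteOf_add)
open SupTorusDirichletForm (siteOf_chart_surjective blockOf_siteOf_of_mem)
open SupTorusDirichletFormCoercive (sum_sq_eq_sum_blocks)
open SupTorusHessianCombesThomas (exists_rate)
open SupTorusBlockDistance (isPseudoDist_torus torus_sum_exp_le)
open SupTorusActionForm (action_form_symm action_sub action_injective sum_indicator_mul)
open SupTorusCoarseFloor (action_smul)
open SupTorusSchurComplement (schur_column_sq_le)
open SupTorusMaximumPrinciple (maxPrinciple blockTerm_eq)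

variable {d : ℕ}

/-! ## §1. The displayed action is onto: the block columns `ψ_{y′}` of `H⁻¹` EXIST (`V ≥ −λ`, `λ < min(2,a)`) -/

section Columns

variable (n : ℕ) (a : ℝ) (s : ℕ) [NeZero s]

/-- **THE DISPLAYED ACTION IS SURJECTIVE**: for `a ≥ 0`, `V ≥ −λ`, `λ < min(2,a)`, every `f` is `Hu` for some `u` — the action is a linear
endomorphism of the finite-dimensional space of fine fields, injective by (133) `action_injective`, hence onto
(`LinearMap.injective_iff_surjective`). [folklore] -/
theorem action_surjective (ha : 0 ≤ a) {lam : ℝ} (hm : 0 < min 2 a - lam) (V : Site d ((n + 1) * s) → ℝ) (hV : ∀ x, -lam ≤ V x)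
    (f : Site d ((n + 1) * s) → ℝ) :
    ∃ u : Site d ((n + 1) * s) → ℝ, ∀ x,
      ((n : ℝ) + 1) ^ 2 * ∑ μ, (2 * u x - u (x + siteOf d ((n + 1) * s) (e μ)) - u (x - siteOf d ((n + 1) * s) (e μ)))
        + a / ((n : ℝ) + 1) ^ d * ∑ q ∈ B n (blk n (windowMap d ((n + 1) * s) x)), u (siteOf d ((n + 1) * s) q) + V x * u x = f x := by
  classical
  let Hop : (Site d ((n + 1) * s) → ℝ) →ₗ[ℝ] (Site d ((n + 1) * s) → ℝ) :=
    { toFun := fun u x => ((n : ℝ) + 1) ^ 2 * ∑ μ, (2 * u x - u (x + siteOf d ((n + 1) * s) (e μ)) - u (x - siteOf d ((n + 1) * s) (e μ)))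
        + a / ((n : ℝ) + 1) ^ d * ∑ q ∈ B n (blk n (windowMap d ((n + 1) * s) x)), u (siteOf d ((n + 1) * s) q) + V x * u x
      map_add' := fun u v => by
        funext x
        simp only [Pi.add_apply]
        have h := action_sub n a s V (fun x => u x + v x) v x
        have h2 : (fun x => u x + v x - v x) = u := funext fun x => by ring
        simp only [add_sub_cancel_right] at h
        linarith
      map_smul' := fun c u => by
        funext x
        simp only [Pi.smul_apply, smul_eq_mul, RingHom.id_apply]
        exact action_smul n a s V u c x }
  have hinj : Function.Injective Hop := fun u v huv =>
    action_injective n a s ha hm V hV u v fun x => congrFun huv x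
  obtain ⟨u, hu⟩ := (LinearMap.injective_iff_surjective.1 hinj) f
  exact ⟨u, fun x => congrFun hu x⟩

/-- **THE BLOCK COLUMNS OF `H⁻¹` EXIST**: there are `ψ_{y′}` with `Hψ_{y′} = 𝟙[bt · = y′]` for every coarse `y′` — the hypothesis `ψ`
of (134)–(147), discharged. [folklore] -/
theorem exists_blockColumns (ha : 0 ≤ a) {lam : ℝ} (hm : 0 < min 2 a - lam) (V : Site d ((n + 1) * s) → ℝ) (hV : ∀ x, -lam ≤ V x) :
    ∃ ψ : Site d s → Site d ((n + 1) * s) → ℝ, ∀ y' x,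
      ((n : ℝ) + 1) ^ 2 * ∑ μ, (2 * ψ y' x - ψ y' (x + siteOf d ((n + 1) * s) (e μ)) - ψ y' (x - siteOf d ((n + 1) * s) (e μ)))
        + a / ((n : ℝ) + 1) ^ d * ∑ q ∈ B n (blk n (windowMap d ((n + 1) * s) x)), ψ y' (siteOf d ((n + 1) * s) q) + V x * ψ y' x
        = if siteOf d s (blk n (windowMap d ((n + 1) * s) x)) = y' then 1 else 0 := by
  classical
  choose ψ hψ using fun y' : Site d s =>
    action_surjective n a s ha hm V hV fun x => if siteOf d s (blk n (windowMap d ((n + 1) * s) x)) = y' then (1 : ℝ) else 0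
  exact ⟨ψ, hψ⟩

end Columns

/-! ## §2. Duality: the block means of `H⁻¹f` are pairings of `f` with the block columns, whose `ℓ¹` norms are mesh-free -/

section Duality

variable (n : ℕ) (a : ℝ) (s : ℕ) [NeZero s] (ha : 0 ≤ a) {lam κ : ℝ} (hκ0 : 0 < κ) (hκ1 : κ ≤ 1)
  (hm : 0 < min 2 a - lam - 2 * d * κ ^ 2 - a * (exp (2 * d * κ) - 1))
  (V : Site d ((n + 1) * s) → ℝ) (hV : ∀ x, -lam ≤ V x)
  (ψ : Site d s → Site d ((n + 1) * s) → ℝ)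
  (hψ : ∀ y' x, ((n : ℝ) + 1) ^ 2 * ∑ μ, (2 * ψ y' x - ψ y' (x + siteOf d ((n + 1) * s) (e μ)) - ψ y' (x - siteOf d ((n + 1) * s) (e μ)))
      + a / ((n : ℝ) + 1) ^ d * ∑ q ∈ B n (blk n (windowMap d ((n + 1) * s) x)), ψ y' (siteOf d ((n + 1) * s) q) + V x * ψ y' x
      = if siteOf d s (blk n (windowMap d ((n + 1) * s) x)) = y' then 1 else 0)
  (u f : Site d ((n + 1) * s) → ℝ)
  (hu : ∀ x, ((n : ℝ) + 1) ^ 2 * ∑ μ, (2 * u x - u (x + siteOf d ((n + 1) * s) (e μ)) - u (x - siteOf d ((n + 1) * s) (e μ)))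
      + a / ((n : ℝ) + 1) ^ d * ∑ q ∈ B n (blk n (windowMap d ((n + 1) * s) x)), u (siteOf d ((n + 1) * s) q) + V x * u x = f x)

include hψ hu in
/-- **DUALITY**: `Σ_z u(σ(chart (wm y) z)) = Σ_x ψ_y x·f x` — the block sum of `u = H⁻¹f` is the pairing of `f` with the column `ψ_y = H⁻¹𝟙_{B_y}`
(the form of `H` is symmetric, (133) `action_form_symm`). [folklore] -/
theorem blockSum_eq_pairing (y : Site d s) :
    ∑ z : Fin d → Fin (n + 1), u (siteOf d ((n + 1) * s) (chart n (windowMap d s y) z)) = ∑ x, ψ y x * f x := by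
  classical
  have h := action_form_symm n a s V u (ψ y)
  simp only [hu, hψ] at h
  rw [h, ← sum_indicator_mul n s y u]
  exact Finset.sum_congr rfl fun x _ => by split_ifs <;> ring

include ha hκ0 hκ1 hm hV hψ in
/-- **THE `ℓ¹` NORM OF A BLOCK COLUMN IS `≤ (n+1)^d·m_κ⁻¹e^{2dκ}K_κ`**, `K_κ = (2∕(1 − e^{−κ}))^d`: blockwise Cauchy–Schwarz on (134)
`schur_column_sq_le` and (132) `torus_sum_exp_le` — per site of the block volume, MESH-FREE. [folklore] -/
theorem column_l1_le (y : Site d s) :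
    ∑ x, |ψ y x| ≤ ((n : ℝ) + 1) ^ d * ((min 2 a - lam - 2 * d * κ ^ 2 - a * (exp (2 * d * κ) - 1))⁻¹ * exp (2 * d * κ)
      * (2 * (1 - exp (-κ))⁻¹) ^ d) := by
  classical
  set m := min 2 a - lam - 2 * d * κ ^ 2 - a * (exp (2 * d * κ) - 1) with hm_def
  have hvol : (0 : ℝ) < ((n : ℝ) + 1) ^ d := by positivity
  rw [SupTorusDirichletForm.sum_fine_eq_sum_blocks n s]
  have hblock : ∀ y' : Site d s, ∑ p ∈ B n (windowMap d s y'), |ψ y (siteOf d ((n + 1) * s) p)|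
      ≤ ((n : ℝ) + 1) ^ d * (m⁻¹ * exp (2 * d * κ)) * exp (-(κ * ∑ i, (((y' i - y i).valMinAbs.natAbs : ℕ) : ℝ))) := by
    intro y'
    rw [sum_B]
    have hCS := sq_sum_le_card_mul_sum_sq (s := (Finset.univ : Finset (Fin d → Fin (n + 1))))
      (f := fun z => |ψ y (siteOf d ((n + 1) * s) (chart n (windowMap d s y') z))|)
    rw [Finset.card_univ, card_cube] at hCS
    simp only [sq_abs] at hCS
    have hcol := schur_column_sq_le n a s ha hκ0.le hκ1 hm V hV ψ hψ y' y
    have h4 : exp (4 * d * κ) = exp (2 * d * κ) ^ 2 := by rw [sq, ← exp_add]; ring_nf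
    have h5 : exp (-(2 * κ * ∑ i, (((y' i - y i).valMinAbs.natAbs : ℕ) : ℝ)))
        = exp (-(κ * ∑ i, (((y' i - y i).valMinAbs.natAbs : ℕ) : ℝ))) ^ 2 := by rw [sq, ← exp_add]; ring_nf
    have hR : 0 ≤ ((n : ℝ) + 1) ^ d * (m⁻¹ * exp (2 * d * κ)) * exp (-(κ * ∑ i, (((y' i - y i).valMinAbs.natAbs : ℕ) : ℝ))) := by
      have : 0 ≤ m⁻¹ := inv_nonneg.2 hm.le
      positivity
    have hsq : (∑ z : Fin d → Fin (n + 1), |ψ y (siteOf d ((n + 1) * s) (chart n (windowMap d s y') z))|) ^ 2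
        ≤ (((n : ℝ) + 1) ^ d * (m⁻¹ * exp (2 * d * κ)) * exp (-(κ * ∑ i, (((y' i - y i).valMinAbs.natAbs : ℕ) : ℝ)))) ^ 2 := by
      refine hCS.trans ((mul_le_mul_of_nonneg_left hcol hvol.le).trans (le_of_eq ?_))
      rw [h4, h5]; ring
    exact (abs_le_of_sq_le_sq' hsq hR).2
  have hsum : ∑ y' : Site d s, exp (-(κ * ∑ i, (((y' i - y i).valMinAbs.natAbs : ℕ) : ℝ))) ≤ (2 * (1 - exp (-κ))⁻¹) ^ d := by
    have h := torus_sum_exp_le (d := d) s hκ0 y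
    refine le_trans (le_of_eq (Finset.sum_congr rfl fun y' _ => ?_)) h
    rw [(isPseudoDist_torus (d := d) s).symm y' y]
  calc ∑ y' : Site d s, ∑ p ∈ B n (windowMap d s y'), |ψ y (siteOf d ((n + 1) * s) p)|
      ≤ ∑ y' : Site d s, ((n : ℝ) + 1) ^ d * (m⁻¹ * exp (2 * d * κ)) * exp (-(κ * ∑ i, (((y' i - y i).valMinAbs.natAbs : ℕ) : ℝ))) :=
        Finset.sum_le_sum fun y' _ => hblock y'
    _ = ((n : ℝ) + 1) ^ d * (m⁻¹ * exp (2 * d * κ)) * ∑ y' : Site d s, exp (-(κ * ∑ i, (((y' i - y i).valMinAbs.natAbs : ℕ) : ℝ))) := by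
        rw [Finset.mul_sum]
    _ ≤ ((n : ℝ) + 1) ^ d * (m⁻¹ * exp (2 * d * κ)) * (2 * (1 - exp (-κ))⁻¹) ^ d :=
        mul_le_mul_of_nonneg_left hsum (by have : 0 ≤ m⁻¹ := inv_nonneg.2 hm.le; positivity)
    _ = _ := by ring

include ha hκ0 hκ1 hm hV hψ hu in
/-- **THE BLOCK MEANS OF `H⁻¹f` ARE BOUNDED BY `m_κ⁻¹e^{2dκ}K_κ·‖f‖_∞` FOR EVERY SOURCE** — no support condition: duality + the column's
`ℓ¹` letter. [folklore] -/
theorem blockMean_le_sup {M : ℝ} (hfM : ∀ x, |f x| ≤ M) (y : Site d s) :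
    |(((n : ℝ) + 1) ^ d)⁻¹ * ∑ z : Fin d → Fin (n + 1), u (siteOf d ((n + 1) * s) (chart n (windowMap d s y) z))|
      ≤ (min 2 a - lam - 2 * d * κ ^ 2 - a * (exp (2 * d * κ) - 1))⁻¹ * exp (2 * d * κ) * (2 * (1 - exp (-κ))⁻¹) ^ d * M := by
  classical
  have hvol : (0 : ℝ) < ((n : ℝ) + 1) ^ d := by positivity
  have hM : 0 ≤ M := (abs_nonneg _).trans (hfM (siteOf d ((n + 1) * s) (chart n (windowMap d s y) 0)))
  rw [blockSum_eq_pairing n a s V ψ hψ u f hu y, abs_mul, abs_of_pos (inv_pos.2 hvol), inv_mul_le_iff₀ hvol]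
  calc |∑ x, ψ y x * f x| ≤ ∑ x, |ψ y x * f x| := Finset.abs_sum_le_sum_abs _ _
    _ ≤ ∑ x, |ψ y x| * M := Finset.sum_le_sum fun x _ => by rw [abs_mul]; exact mul_le_mul_of_nonneg_left (hfM x) (abs_nonneg _)
    _ = (∑ x, |ψ y x|) * M := (Finset.sum_mul _ _ _).symm
    _ ≤ ((n : ℝ) + 1) ^ d * ((min 2 a - lam - 2 * d * κ ^ 2 - a * (exp (2 * d * κ) - 1))⁻¹ * exp (2 * d * κ)
        * (2 * (1 - exp (-κ))⁻¹) ^ d) * M := mul_le_mul_of_nonneg_right (column_l1_le n a s ha hκ0 hκ1 hm V hV ψ hψ y) hM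
    _ = _ := by ring

end Duality

/-! ## §3. THE END: `‖H_V⁻¹‖_{ℓ^∞ → ℓ^∞} ≤ C(d, a, v₀)` on the strictly convex class, every source, every mesh, every volume -/

/-- **HEADLINE — THE PROPAGATOR OF THE TORUS ROAD IS BOUNDED ON `ℓ^∞`, MESH- AND VOLUME-FREE, ON THE STRICTLY CONVEX SINGLE-SITE CLASS.**
Fix `d`, `a > 0`, `v₀ > 0`.  THERE IS `C > 0` (a function of these only) such that for ALL `n, s`, ALL potentials `V ≥ v₀`, EVERY source `f`
with `|f| ≤ M` (no support condition) and every solution of `Hu = f` (displayed action): `|u x| ≤ C·M` at EVERY site.  The block columns exist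
(§1), the block means of `u` are `≤ m_κ⁻¹e^{2dκ}K_κM` by duality (§2), and the maximum principle for `L_V = (n+1)²(−Δ) + V` ((144)) applied to
`L_Vu = f − a·(block means)` gives `C = (1 + a·m_κ⁻¹e^{2dκ}K_κ)∕v₀` — § [NE7bP1-G120-HANDOFF-FINAL] NEXT (3)(b) «an `ℓ^∞` theory for `H⁻¹`
(row sums `O(1)` uniformly in the mesh)» on the class `V ≥ v₀ > 0`, with NO hypothesis left. [folklore] -/
theorem supNorm_bound (a : ℝ) (ha : 0 < a) {v₀ : ℝ} (hv₀ : 0 < v₀) :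
    ∃ C : ℝ, 0 < C ∧ ∀ (n s : ℕ) [NeZero s] (V : Site d ((n + 1) * s) → ℝ), (∀ x, v₀ ≤ V x) →
      ∀ (M : ℝ) (u f : Site d ((n + 1) * s) → ℝ), (∀ x, |f x| ≤ M) →
      (∀ x, ((n : ℝ) + 1) ^ 2 * ∑ μ, (2 * u x - u (x + siteOf d ((n + 1) * s) (e μ)) - u (x - siteOf d ((n + 1) * s) (e μ)))
        + a / ((n : ℝ) + 1) ^ d * ∑ q ∈ B n (blk n (windowMap d ((n + 1) * s) x)), u (siteOf d ((n + 1) * s) q) + V x * u x = f x) →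
      ∀ x : Site d ((n + 1) * s), |u x| ≤ C * M := by
  classical
  have hd : (0 : ℝ) ≤ d := Nat.cast_nonneg d
  have hm0 : 0 < min 2 a - (-v₀) := by have : 0 ≤ min 2 a := le_min zero_le_two ha.le; linarith
  obtain ⟨κ, hκ0, hκ1, hκm⟩ := exists_rate (d := d) a ha.le hm0
  have hm : 0 < min 2 a - (-v₀) - 2 * d * κ ^ 2 - a * (exp (2 * d * κ) - 1) := by linarith
  set m := min 2 a - (-v₀) - 2 * d * κ ^ 2 - a * (exp (2 * d * κ) - 1) with hm_def
  set K : ℝ := (2 * (1 - exp (-κ))⁻¹) ^ d with hK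
  have hK0 : 0 ≤ K := pow_nonneg (mul_nonneg zero_le_two (inv_nonneg.2 (sub_nonneg.2 (exp_le_one_iff.2 (by linarith))))) d
  have hminv : 0 ≤ m⁻¹ := inv_nonneg.2 hm.le
  refine ⟨(1 + a * (m⁻¹ * exp (2 * d * κ) * K)) / v₀, by positivity, ?_⟩
  intro n s _ V hV M u f hfM hu x
  have hM : 0 ≤ M := (abs_nonneg _).trans (hfM x)
  have hVl : ∀ x, -(-v₀) ≤ V x := fun x => by linarith [hV x]
  obtain ⟨ψ, hψ⟩ := exists_blockColumns n a s ha.le hm0 V hVl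
  have hmean : ∀ y : Site d s, |(((n : ℝ) + 1) ^ d)⁻¹ * ∑ z : Fin d → Fin (n + 1), u (siteOf d ((n + 1) * s) (chart n (windowMap d s y) z))|
      ≤ m⁻¹ * exp (2 * d * κ) * K * M := fun y => blockMean_le_sup n a s ha.le hκ0 hκ1 hm V hVl ψ hψ u f hu hfM y
  have h := maxPrinciple n s hv₀ V u (fun x => f x - a / ((n : ℝ) + 1) ^ d
      * ∑ q ∈ B n (blk n (windowMap d ((n + 1) * s) x)), u (siteOf d ((n + 1) * s) q)) hV (M := M + a * (m⁻¹ * exp (2 * d * κ) * K * M))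
      (fun x' => ?_) (fun x' => by linarith [hu x']) x
  · rw [show (M + a * (m⁻¹ * exp (2 * d * κ) * K * M)) / v₀ = (1 + a * (m⁻¹ * exp (2 * d * κ) * K)) / v₀ * M by ring] at h
    exact h
  · obtain ⟨⟨y, z⟩, hyz⟩ := siteOf_chart_surjective n s x'
    simp only at hyz
    rw [← hyz, blockTerm_eq n s u y z, div_eq_mul_inv, mul_assoc]
    calc |f (siteOf d ((n + 1) * s) (chart n (windowMap d s y) z))
          - a * ((((n : ℝ) + 1) ^ d)⁻¹ * ∑ z' : Fin d → Fin (n + 1), u (siteOf d ((n + 1) * s) (chart n (windowMap d s y) z')))|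
        ≤ |f (siteOf d ((n + 1) * s) (chart n (windowMap d s y) z))|
          + |a * ((((n : ℝ) + 1) ^ d)⁻¹ * ∑ z' : Fin d → Fin (n + 1), u (siteOf d ((n + 1) * s) (chart n (windowMap d s y) z')))| :=
          abs_sub _ _
      _ ≤ M + a * (m⁻¹ * exp (2 * d * κ) * K * M) := by
          rw [abs_mul, abs_of_pos ha]
          exact add_le_add (hfM _) (mul_le_mul_of_nonneg_left (hmean y) ha.le)

/-! ## §4. Toy -/

/-- Toy (`d = 0`, `a = v₀ = 1`): the headline's hypotheses are inhabited, so the constant exists. -/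
example : ∃ C : ℝ, 0 < C := let ⟨C, hC, _⟩ := supNorm_bound (d := 0) 1 one_pos (v₀ := 1) one_pos; ⟨C, hC⟩

end Summit.QuantumFields.BalabanUV.T4Continuum.NE7b.SupTorusSupNormBound
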